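import Summits.BirchSwinnertonDyer.Rank1Residual.GaloisImage.ThreeCongruenceHesseCertificateLemmas
import Literature.NumberTheory.EllipticCurves.Fisher2012.HesseFamilyThreeReverseProofs
import Summits.BirchSwinnertonDyer.Rank1Residual.Additive.IntModelTamagawaCertificate
import Summits.BirchSwinnertonDyer.Rank1Residual.GaloisImage.ThreeCongruenceHesseCertificatesV40A
import Summits.BirchSwinnertonDyer.BirchSwinnertonDyer.Theorems.Rank2ObservatoryKernelCerts022
import Summits.BirchSwinnertonDyer.Rank1Residual.Additive.X4ThreeVisibleTateRowShape2601h1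
import Summits.BirchSwinnertonDyer.BirchSwinnertonDyer.Theorems.Rank2ObservatoryKernelCerts043
import Summits.BirchSwinnertonDyer.Rank1Residual.Additive.X4ThreeVisibleTateRowShape3879e1
import Summits.BirchSwinnertonDyer.BirchSwinnertonDyer.Theorems.Rank2ObservatoryKernelCerts086
import Summits.BirchSwinnertonDyer.Rank1Residual.Additive.X4ThreeVisibleTateRowShape6165g1
import Summits.BirchSwinnertonDyer.BirchSwinnertonDyer.Theorems.Rank2ObservatoryKernelCertsF04
import Summits.BirchSwinnertonDyer.Rank1Residual.Additive.X4ThreeVisibleTateRowShape6336cn1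
import Summits.BirchSwinnertonDyer.BirchSwinnertonDyer.Theorems.Rank2ObservatoryKernelCertsB04
import Summits.BirchSwinnertonDyer.Rank1Residual.Additive.X4ThreeVisibleTateRowShape7488o1
import HarnessLib

/-!
# Record shapes with the C-VIS `θ/hθ` column AND the rank column DISCHARGED IN THE KERNEL — `T-VIS3-TATE records (p14 lineage), part 1: 2601h1 3879e1 6165g1 6336cn1 7488o1`
# (cell `b2b-bsdres`, team n1011, ROW T-VIS3-TH; seat p07 lineage; skeleton cells/n1011/skel/T-VIS3-TH.md;
# generated by `tools/gen_twins2.py` from the TREE text of the records — consumed BY NAME, nothing edited)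

HONEST FRAMING (cell `b2b-bsdres`, run/shared/lean/b2b/bsd-rank1-residual/, verbatim in every
file): the goal of the cell is to DELETE the COMBINATION-SHAPED residual classes of the
Birch–Swinnerton-Dyer formula for ALL analytic-rank `≤ 1` elliptic curves over `ℚ` — "full BSD
formula for every rank `≤ 1` curve in class `C`" assembled STRICTLY from published theorems — so
that the rank-`≤ 1` remainder becomes exactly the CONSTRUCTION-SHAPED classes, which are TYPED
(missing-input `Prop`s), NOT attempted. This is not "finishing BSD". Team n1011 (N11 = X4 ∧ `p = 3`):
research route; RECORD theorems only — NO definition, NO new named fact, NO `sorry`; a record closes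
NO class and moves no mark / label / count; nothing booked; census count unchanged.

## What

For each record `R` below (a tree theorem displaying the C-VIS EVIDENCE columns
`(W') (hW' : W' = E′) [W'.IsElliptic] (θ : E′[3] ≃+ E[3]) (hθ : Γ_ℚ-equivariant) (hrank : 2 ≤ rank E′(ℚ))`),
the twin `RHesse` := `R` with those binders DISCHARGED: θ/hθ by the `n = 3` Hesse-pencil certificate of
Fisher 2012 Thm. 13.2 (DIRECT = `X_E(3)`, or DUAL = `X_E⁻(3)` — unconditional, A243 is the tree theorem
`Fisher2012.thm132rev_threeCongruent_dualHessePencil_holds`), either the tree certificate theorem BY NAME or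
ONE call of `VisCerts.torsionIso3_of_hesseCert_mk` / `…_of_dualHesseCert_mk`
(`GaloisImage/ThreeCongruenceHesseCertificateLemmas.lean`) with the certificate `(l : m)`, `u` and ten
`norm_num` identities; hrank by the bsd-rank2-observatory KERNEL certificate of `E′` BY NAME. Every other
binder is the record's own, token for token.

| record | twin | partner | θ certificate | rank certificate |
|---|---|---|---|---|
| `bsdp3_visT_v2601h1` | `bsdp3_visTHesse_v2601h1` | 2601l1 | tree:torsionIso3_2601l1_2601h1_of_integralModelInt | percurve |
| `bsdp3_visT_v3879e1` | `bsdp3_visTHesse_v3879e1` | 3879d1 | tree:torsionIso3_3879d1_3879e1_of_integralModelInt | percurve |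
| `bsdp3_visT_v6165g1` | `bsdp3_visTHesse_v6165g1` | 6165h1 | tree:torsionIso3_6165h1_6165g1_of_integralModelInt | percurve |
| `bsdp3_visT_v6336cn1` | `bsdp3_visTHesse_v6336cn1` | 6336ck1 | direct | percurve |
| `bsdp3_visT_v7488o1` | `bsdp3_visTHesse_v7488o1` | 7488u1 | direct | percurve |

References: [Fisher2012Hessian] T. Fisher, The Hessian of a genus one curve, Proc. LMS 104 (2012),
Thm. 13.2 / §13; [CremonaMazur2000] §3; [CremonaAlgorithms1997] §3.5; [SilvermanAEC2009] VIII.6.7.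
-/

set_option autoImplicit false

noncomputable section

open scoped Classical NumberField
open IsDedekindDomain NumberField WeierstrassCurve Rat.HeightOneSpectrum
  Literature.NumberTheory.EllipticCurves Literature.NumberTheory.EllipticCurves.ModularForms
  Literature.NumberTheory.EllipticCurves.Rank1Residual
  Literature.NumberTheory.EllipticCurves.Rank1Residual.Typed
  Literature.NumberTheory.EllipticCurves.Fisher2012
  Literature.NumberTheory.GaloisRepresentations
  Summit.BirchSwinnertonDyer.BirchSwinnertonDyer.Rank1Residual.IntModel
  Summit.BirchSwinnertonDyer.BirchSwinnertonDyer.Rank1Residual.X11RankOne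
  Summit.BirchSwinnertonDyer.BirchSwinnertonDyer.Rank2Observatory.Tam
  Summit.BirchSwinnertonDyer.BirchSwinnertonDyer.Rank2Observatory
  Summit.BirchSwinnertonDyer.Rank1Residual.GaloisImage

namespace Summit.BirchSwinnertonDyer.Rank1Residual.Additive

/-- **Record `bsdp3_visT_v2601h1` (`Additive/X4ThreeVisibleTateRowShape2601h1.lean`) with the C-VIS
columns θ/hθ AND hrank DISCHARGED IN THE KERNEL** — partner `2601l1` = `⟨0,0,1,51,72⟩`: θ by tree
certificate `VisCerts.torsionIso3_2601l1_2601h1_of_integralModelInt`; rank by the bsdr2 kernel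
certificate `KernelCerts022.C2601l1.two_le_rank`. Every other binder is the record's, verbatim;
closes nothing beyond them; nothing booked; census count unchanged.
[cite: Fisher2012Hessian, Thm. 13.2 (n = 3)] [cite: CremonaAlgorithms1997, §3.5] -/
theorem bsdp3_visTHesse_v2601h1
    (hKatoS : Kato2004.rankZero_padicValNat_sha_le_sub_localTamagawa_of_additive_potGood_of_imageContainsSL2)
    (hDel : Delbourgo1998.prop4_rankZero_pow_dvd_constantCoeff)
    (hGZK : rank_eq_analyticRank_of_analyticRank_le_one) (hmod : hasEntireLFunction_rat)
    (hmodD : nonempty_modularParametrizationData)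
    (hKatoχ : Wuthrich2014.kato_halfEigenCharIdeal_dvd_cyclotomicPrime_of_surjective)
    (hCT : exists_casselsTate_pairing (K := ℚ))
    (hU : Silverman1994_thmV53_tateUniformisation.{0})
    (hU2 : Silverman1994_thmV53_corV54_tateUniformisation.{0})
    (W : WeierstrassCurve ℚ) [W.IsElliptic] [W.IsGloballyMinimal]
    (hI : integralModelInt W = ⟨1, -1, 0, -59877, -3934008⟩)
    (hr : W.analyticRank = 0)
    {q : ℚ} (hq : shaAn W = (q : ℂ)) (hv : padicValRat 3 q ≤ 2) :
    haveI : Fact (Nat.Prime 3) := ⟨Nat.prime_three⟩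
    BSDp W 3 := by
  haveI : (⟨0, 0, 1, 51, 72⟩ : WeierstrassCurve ℚ).IsElliptic :=
    ⟨by rw [isUnit_iff_ne_zero]
        norm_num [WeierstrassCurve.Δ, WeierstrassCurve.b₂, WeierstrassCurve.b₄, WeierstrassCurve.b₆,
          WeierstrassCurve.b₈]⟩
  obtain ⟨θ, hθ⟩ := VisCerts.torsionIso3_2601l1_2601h1_of_integralModelInt W hI ⟨0, 0, 1, 51, 72⟩ rfl
  have hE' : (⟨0, 0, 1, 51, 72⟩ : WeierstrassCurve ℤ).map (Int.castRingHom ℚ) =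
      (⟨0, 0, 1, 51, 72⟩ : WeierstrassCurve ℚ) := by
    ext <;> simp [WeierstrassCurve.map]
  have hrank : 2 ≤ (⟨0, 0, 1, 51, 72⟩ : WeierstrassCurve ℚ).mordellWeilRank := by
    rw [← hE']; simpa only [KernelCerts022.C2601l1.V] using KernelCerts022.C2601l1.two_le_rank
  exact bsdp3_visT_v2601h1 hKatoS hDel hGZK hmod hmodD hKatoχ hCT hU hU2 W hI hr hq hv _ rfl θ hθ hrank

/-- **Record `bsdp3_visT_v3879e1` (`Additive/X4ThreeVisibleTateRowShape3879e1.lean`) with the C-VIS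
columns θ/hθ AND hrank DISCHARGED IN THE KERNEL** — partner `3879d1` = `⟨1,-1,1,-41,182⟩`: θ by tree
certificate `VisCerts.torsionIso3_3879d1_3879e1_of_integralModelInt`; rank by the bsdr2 kernel
certificate `KernelCerts043.C3879d1.two_le_rank`. Every other binder is the record's, verbatim;
closes nothing beyond them; nothing booked; census count unchanged.
[cite: Fisher2012Hessian, Thm. 13.2 (n = 3)] [cite: CremonaAlgorithms1997, §3.5] -/
theorem bsdp3_visTHesse_v3879e1
    (hKatoS : Kato2004.rankZero_padicValNat_sha_le_sub_localTamagawa_of_additive_potGood_of_imageContainsSL2)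
    (hDel : Delbourgo1998.prop4_rankZero_pow_dvd_constantCoeff)
    (hGZK : rank_eq_analyticRank_of_analyticRank_le_one) (hmod : hasEntireLFunction_rat)
    (hmodD : nonempty_modularParametrizationData)
    (hKatoχ : Wuthrich2014.kato_halfEigenCharIdeal_dvd_cyclotomicPrime_of_surjective)
    (hCT : exists_casselsTate_pairing (K := ℚ))
    (hU2 : Silverman1994_thmV53_corV54_tateUniformisation.{0})
    (W : WeierstrassCurve ℚ) [W.IsElliptic] [W.IsGloballyMinimal]
    (hI : integralModelInt W = ⟨0, 0, 1, -57333, -5282919⟩)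
    (hr : W.analyticRank = 0)
    {q : ℚ} (hq : shaAn W = (q : ℂ)) (hv : padicValRat 3 q ≤ 2) :
    haveI : Fact (Nat.Prime 3) := ⟨Nat.prime_three⟩
    BSDp W 3 := by
  haveI : (⟨1, -1, 1, -41, 182⟩ : WeierstrassCurve ℚ).IsElliptic :=
    ⟨by rw [isUnit_iff_ne_zero]
        norm_num [WeierstrassCurve.Δ, WeierstrassCurve.b₂, WeierstrassCurve.b₄, WeierstrassCurve.b₆,
          WeierstrassCurve.b₈]⟩
  obtain ⟨θ, hθ⟩ := VisCerts.torsionIso3_3879d1_3879e1_of_integralModelInt W hI ⟨1, -1, 1, -41, 182⟩ rfl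
  have hE' : (⟨1, -1, 1, -41, 182⟩ : WeierstrassCurve ℤ).map (Int.castRingHom ℚ) =
      (⟨1, -1, 1, -41, 182⟩ : WeierstrassCurve ℚ) := by
    ext <;> simp [WeierstrassCurve.map]
  have hrank : 2 ≤ (⟨1, -1, 1, -41, 182⟩ : WeierstrassCurve ℚ).mordellWeilRank := by
    rw [← hE']; exact KernelCerts043.C3879d1.two_le_rank
  exact bsdp3_visT_v3879e1 hKatoS hDel hGZK hmod hmodD hKatoχ hCT hU2 W hI hr hq hv _ rfl θ hθ hrank

/-- **Record `bsdp3_visT_v6165g1` (`Additive/X4ThreeVisibleTateRowShape6165g1.lean`) with the C-VIS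
columns θ/hθ AND hrank DISCHARGED IN THE KERNEL** — partner `6165h1` = `⟨1,-1,1,-797,-4354⟩`: θ by
tree certificate `VisCerts.torsionIso3_6165h1_6165g1_of_integralModelInt`; rank by the bsdr2 kernel
certificate `KernelCerts086.C6165h1.two_le_rank`. Every other binder is the record's, verbatim;
closes nothing beyond them; nothing booked; census count unchanged.
[cite: Fisher2012Hessian, Thm. 13.2 (n = 3)] [cite: CremonaAlgorithms1997, §3.5] -/
theorem bsdp3_visTHesse_v6165g1
    (hKatoS : Kato2004.rankZero_padicValNat_sha_le_sub_localTamagawa_of_additive_potGood_of_imageContainsSL2)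
    (hDel : Delbourgo1998.prop4_rankZero_pow_dvd_constantCoeff)
    (hGZK : rank_eq_analyticRank_of_analyticRank_le_one) (hmod : hasEntireLFunction_rat)
    (hmodD : nonempty_modularParametrizationData)
    (hKatoχ : Wuthrich2014.kato_halfEigenCharIdeal_dvd_cyclotomicPrime_of_surjective)
    (hCT : exists_casselsTate_pairing (K := ℚ))
    (hU : Silverman1994_thmV53_tateUniformisation.{0})
    (hU2 : Silverman1994_thmV53_corV54_tateUniformisation.{0})
    (W : WeierstrassCurve ℚ) [W.IsElliptic] [W.IsGloballyMinimal]
    (hI : integralModelInt W = ⟨1, -1, 1, -54257, -5478496⟩)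
    (hr : W.analyticRank = 0)
    {q : ℚ} (hq : shaAn W = (q : ℂ)) (hv : padicValRat 3 q ≤ 2) :
    haveI : Fact (Nat.Prime 3) := ⟨Nat.prime_three⟩
    BSDp W 3 := by
  haveI : (⟨1, -1, 1, -797, -4354⟩ : WeierstrassCurve ℚ).IsElliptic :=
    ⟨by rw [isUnit_iff_ne_zero]
        norm_num [WeierstrassCurve.Δ, WeierstrassCurve.b₂, WeierstrassCurve.b₄, WeierstrassCurve.b₆,
          WeierstrassCurve.b₈]⟩
  obtain ⟨θ, hθ⟩ := VisCerts.torsionIso3_6165h1_6165g1_of_integralModelInt W hI ⟨1, -1, 1, -797, -4354⟩ rfl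
  have hE' : (⟨1, -1, 1, -797, -4354⟩ : WeierstrassCurve ℤ).map (Int.castRingHom ℚ) =
      (⟨1, -1, 1, -797, -4354⟩ : WeierstrassCurve ℚ) := by
    ext <;> simp [WeierstrassCurve.map]
  have hrank : 2 ≤ (⟨1, -1, 1, -797, -4354⟩ : WeierstrassCurve ℚ).mordellWeilRank := by
    rw [← hE']; exact KernelCerts086.C6165h1.two_le_rank
  exact bsdp3_visT_v6165g1 hKatoS hDel hGZK hmod hmodD hKatoχ hCT hU hU2 W hI hr hq hv _ rfl θ hθ hrank

/-- **Record `bsdp3_visT_v6336cn1` (`Additive/X4ThreeVisibleTateRowShape6336cn1.lean`) with the C-VIS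
columns θ/hθ AND hrank DISCHARGED IN THE KERNEL** — partner `6336ck1` = `⟨0,0,0,24,1240⟩`: θ by ONE
call of `VisCerts.torsionIso3_of_hesseCert_mk` with the DIRECT Hesse certificate `(l : m) = (-3720 :
1)`, `u = 288` (`c₄, c₆` of E / E′ = `13852224, 51555985920` / `-1152, -1071360`; r2 GEN 25 search
library, exact); rank by the bsdr2 kernel certificate `KernelCertsF04.C6336ck1.two_le_rank`. Every
other binder is the record's, verbatim; closes nothing beyond them; nothing booked; census count
unchanged.
[cite: Fisher2012Hessian, Thm. 13.2 (n = 3)] [cite: CremonaAlgorithms1997, §3.5] -/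
theorem bsdp3_visTHesse_v6336cn1
    (hKatoS : Kato2004.rankZero_padicValNat_sha_le_sub_localTamagawa_of_additive_potGood_of_imageContainsSL2)
    (hDel : Delbourgo1998.prop4_rankZero_pow_dvd_constantCoeff)
    (hGZK : rank_eq_analyticRank_of_analyticRank_le_one) (hmod : hasEntireLFunction_rat)
    (hmodD : nonempty_modularParametrizationData)
    (hKatoχ : Wuthrich2014.kato_halfEigenCharIdeal_dvd_cyclotomicPrime_of_surjective)
    (hCT : exists_casselsTate_pairing (K := ℚ))
    (hU : Silverman1994_thmV53_tateUniformisation.{0})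
    (hU2 : Silverman1994_thmV53_corV54_tateUniformisation.{0})
    (W : WeierstrassCurve ℚ) [W.IsElliptic] [W.IsGloballyMinimal]
    (hI : integralModelInt W = ⟨0, 0, 0, -288588, -59671280⟩)
    (hr : W.analyticRank = 0)
    {q : ℚ} (hq : shaAn W = (q : ℂ)) (hv : padicValRat 3 q ≤ 2) :
    haveI : Fact (Nat.Prime 3) := ⟨Nat.prime_three⟩
    BSDp W 3 := by
  haveI : (⟨0, 0, 0, 24, 1240⟩ : WeierstrassCurve ℚ).IsElliptic :=
    ⟨by rw [isUnit_iff_ne_zero]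
        norm_num [WeierstrassCurve.Δ, WeierstrassCurve.b₂, WeierstrassCurve.b₄, WeierstrassCurve.b₆,
          WeierstrassCurve.b₈]⟩
  have hWlit : W = ⟨0, 0, 0, -288588, -59671280⟩ := by
    rw [IntModelTam.eq_baseChange_of_integralModelInt hI]; exact IntModelTam.baseChange_rat_mk_int _ _ _ _ _
  obtain ⟨θ, hθ⟩ := VisCerts.torsionIso3_of_hesseCert_mk
    (W' := (⟨0, 0, 0, 24, 1240⟩ : WeierstrassCurve ℚ)) hWlit rfl
    13852224 51555985920 (-1152) (-1071360) (by norm_num) (by norm_num) (by norm_num) (by norm_num)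
    (-3720) 1 288 (by norm_num) (by norm_num) (by norm_num)
  have hE' : (⟨0, 0, 0, 24, 1240⟩ : WeierstrassCurve ℤ).map (Int.castRingHom ℚ) =
      (⟨0, 0, 0, 24, 1240⟩ : WeierstrassCurve ℚ) := by
    ext <;> simp [WeierstrassCurve.map]
  have hrank : 2 ≤ (⟨0, 0, 0, 24, 1240⟩ : WeierstrassCurve ℚ).mordellWeilRank := by
    rw [← hE']; exact KernelCertsF04.C6336ck1.two_le_rank
  exact bsdp3_visT_v6336cn1 hKatoS hDel hGZK hmod hmodD hKatoχ hCT hU hU2 W hI hr hq hv _ rfl θ hθ hrank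

/-- **Record `bsdp3_visT_v7488o1` (`Additive/X4ThreeVisibleTateRowShape7488o1.lean`) with the C-VIS
columns θ/hθ AND hrank DISCHARGED IN THE KERNEL** — partner `7488u1` = `⟨0,0,0,-192,-920⟩`: θ by ONE
call of `VisCerts.torsionIso3_of_hesseCert_mk` with the DIRECT Hesse certificate `(l : m) = (2760 :
1)`, `u = 18432` (`c₄, c₆` of E / E′ = `539712, 8277880320` / `9216, 794880`; r2 GEN 25 search
library, exact); rank by the bsdr2 kernel certificate `KernelCertsB04.C7488u1.two_le_rank`. Every
other binder is the record's, verbatim; closes nothing beyond them; nothing booked; census count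
unchanged.
[cite: Fisher2012Hessian, Thm. 13.2 (n = 3)] [cite: CremonaAlgorithms1997, §3.5] -/
theorem bsdp3_visTHesse_v7488o1
    (hKatoS : Kato2004.rankZero_padicValNat_sha_le_sub_localTamagawa_of_additive_potGood_of_imageContainsSL2)
    (hDel : Delbourgo1998.prop4_rankZero_pow_dvd_constantCoeff)
    (hGZK : rank_eq_analyticRank_of_analyticRank_le_one) (hmod : hasEntireLFunction_rat)
    (hmodD : nonempty_modularParametrizationData)
    (hKatoχ : Wuthrich2014.kato_halfEigenCharIdeal_dvd_cyclotomicPrime_of_surjective)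
    (hCT : exists_casselsTate_pairing (K := ℚ))
    (hU : Silverman1994_thmV53_tateUniformisation.{0})
    (hU2 : Silverman1994_thmV53_corV54_tateUniformisation.{0})
    (W : WeierstrassCurve ℚ) [W.IsElliptic] [W.IsGloballyMinimal]
    (hI : integralModelInt W = ⟨0, 0, 0, -11244, -9580880⟩)
    (hr : W.analyticRank = 0)
    {q : ℚ} (hq : shaAn W = (q : ℂ)) (hv : padicValRat 3 q ≤ 2) :
    haveI : Fact (Nat.Prime 3) := ⟨Nat.prime_three⟩
    BSDp W 3 := by
  haveI : (⟨0, 0, 0, -192, -920⟩ : WeierstrassCurve ℚ).IsElliptic :=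
    ⟨by rw [isUnit_iff_ne_zero]
        norm_num [WeierstrassCurve.Δ, WeierstrassCurve.b₂, WeierstrassCurve.b₄, WeierstrassCurve.b₆,
          WeierstrassCurve.b₈]⟩
  have hWlit : W = ⟨0, 0, 0, -11244, -9580880⟩ := by
    rw [IntModelTam.eq_baseChange_of_integralModelInt hI]; exact IntModelTam.baseChange_rat_mk_int _ _ _ _ _
  obtain ⟨θ, hθ⟩ := VisCerts.torsionIso3_of_hesseCert_mk
    (W' := (⟨0, 0, 0, -192, -920⟩ : WeierstrassCurve ℚ)) hWlit rfl
    539712 8277880320 9216 794880 (by norm_num) (by norm_num) (by norm_num) (by norm_num)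
    2760 1 18432 (by norm_num) (by norm_num) (by norm_num)
  have hE' : (⟨0, 0, 0, -192, -920⟩ : WeierstrassCurve ℤ).map (Int.castRingHom ℚ) =
      (⟨0, 0, 0, -192, -920⟩ : WeierstrassCurve ℚ) := by
    ext <;> simp [WeierstrassCurve.map]
  have hrank : 2 ≤ (⟨0, 0, 0, -192, -920⟩ : WeierstrassCurve ℚ).mordellWeilRank := by
    rw [← hE']; exact KernelCertsB04.C7488u1.two_le_rank
  exact bsdp3_visT_v7488o1 hKatoS hDel hGZK hmod hmodD hKatoχ hCT hU hU2 W hI hr hq hv _ rfl θ hθ hrank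

end Summit.BirchSwinnertonDyer.Rank1Residual.Additive

end
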